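import Mathlib
import Summits.AtomisticToContinuum.Crystallization.Theorems.ChargedEnergyGap.Negative.Unconditional
import Summits.AtomisticToContinuum.Crystallization.Theorems.ChessboardParticlePlanesLjLaminarWindowsGlueLevels
import Summits.AtomisticToContinuum.Crystallization.Theorems.ChessboardParticlePlanesLjLaminarWindowsMinDistance
import Summits.AtomisticToContinuum.Crystallization.Theorems.ChessboardParticlePlanesLjLaminarWindowsEarnshaw
import Literature.MathematicalPhysics.StatisticalMechanics.LennardJonesClusters
import HarnessLib

/-!
# Glue of the alternative cohesion branch of line `Sketch` (crux `LjLaminarWindows`, stmt-AtomisticToContinuum-6711), lead c5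

Registered stub `stub_glueC5` (skeleton rev. 8, card `Cruxes/LjLaminarWindows/Ideas/subadditive-shells.md`):
a.e. laminarity (14293) + bounded spiky scales (`stub_boundedSpikes`, the bet) + window removal + shell
bound + path count ⇒ the crux.  (1) `glueC5_scales`: failure at unboundedly many radii would make every
large `x^N` spiky at `K₀ + 1` separated scales; (2) `glueC5_markov`: at a non-spiky `N` some particle is
thin-shelled AND laminar; (3) window removal + shell bound give its energy clause, `laminar_of_levels`
the isometry; `7/10`-separation and Earnshaw connectivity of ground states are the landed inputs.
-/

noncomputable section

open scoped BigOperators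
open Filter Topology
open Literature.MathematicalPhysics.StatisticalMechanics
open Summit.AtomisticToContinuum.Crystallization.Theorems.ChargedEnergyGapNegative

namespace Summit.AtomisticToContinuum.Crystallization.Theorems.LjLaminarWindowsSketch

/-! ## Connectivity at `23/20` -/

/-- `d⁶ ≤ 11/5` ⇒ `d ≤ 23/20` (`(23/20)⁶ > 11/5`). [folklore] -/
theorem glueC5_le_of_pow_six_le {d : ℝ} (h : d ^ 6 ≤ 11 / 5) : d ≤ 23 / 20 := by
  by_contra hlt
  have hlt' : (23 : ℝ) / 20 < d := lt_of_not_ge hlt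
  have h6 : ((23 : ℝ) / 20) ^ 6 < d ^ 6 := pow_lt_pow_left₀ hlt' (by norm_num) (by norm_num)
  linarith [show (11 : ℝ) / 5 < ((23 : ℝ) / 20) ^ 6 by norm_num]

/-- **`23/20`-connectivity of Lennard-Jones ground states** (from the Earnshaw cross pair
`dist⁶ ≤ 11/5`, `earnshaw_exists_cross_pair`): every non-empty proper group has a member within
`23/20` of a non-member. [folklore] -/
theorem glueC5_connected {N : ℕ} {x : Fin N → EuclideanSpace ℝ (Fin 3)}
    (hx : IsGroundState lennardJones x) :
    ∀ S : Finset (Fin N), S.Nonempty → Sᶜ.Nonempty →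
      ∃ p ∈ S, ∃ k ∈ Sᶜ, dist (x p) (x k) ≤ 23 / 20 := by
  intro S hS hSc
  obtain ⟨p, hp, k, hk, hpk⟩ := earnshaw_exists_cross_pair hx hS hSc
  exact ⟨p, hp, k, hk, glueC5_le_of_pow_six_le hpk⟩

/-! ## Counting over centres -/

/-- Summing a relation's fibre cardinalities over the first variable counts the related ordered
pairs. [folklore] -/
theorem glueC5_sum_card_filter {α : Type*} [Fintype α] (r : α → α → Prop) [DecidableRel r] :
    ∑ i, ((Finset.univ.filter fun j => r i j).card : ℝ) =
      ((Finset.univ.filter fun p : α × α => r p.1 p.2).card : ℝ) := by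
  have h : ∑ i, (Finset.univ.filter fun j => r i j).card =
      (Finset.univ.filter fun p : α × α => r p.1 p.2).card := by
    rw [Finset.card_filter, ← Finset.univ_product_univ, Finset.sum_product]
    refine Finset.sum_congr rfl fun i _ => ?_
    rw [Finset.card_filter]
  exact_mod_cast h

/-- The sum over centres `i` of the number of particles `j` with `P (dist (x j) (x i))` is the number
of ordered pairs `p` with `P (dist (x p.1) (x p.2))`. [folklore] -/
theorem glueC5_sum_card_dist {N : ℕ} (x : Fin N → E3) (P : ℝ → Prop) [DecidablePred P] :
    ∑ i : Fin N, ((Finset.univ.filter fun j : Fin N => P (dist (x j) (x i))).card : ℝ) =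
      ((Finset.univ.filter fun p : Fin N × Fin N => P (dist (x p.1) (x p.2))).card : ℝ) := by
  classical
  rw [glueC5_sum_card_filter (fun i j : Fin N => P (dist (x j) (x i)))]
  congr 2
  refine Finset.filter_congr fun p _ => ?_
  rw [dist_comm]

/-! ## Markov over centres -/

/-- **Markov over centres.** Weights `1 ≤ w i ≤ W`, non-negative shell counts `s i` with
`∑ s ≤ (κ/2) ∑ w`, and fewer than `n/(2W)` non-laminar indices: some index is both thin-shelled
(`s i ≤ κ w i`) and laminar. (Otherwise the thin-shelled indices are all non-laminar and carry weight
`< n/2`, the others carry weight `< ∑ s/κ ≤ ∑ w/2`, against `∑ w ≥ n`.) [folklore] -/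
theorem glueC5_markov {ι : Type*} [Fintype ι] (w s : ι → ℝ) (lam : ι → Prop) [DecidablePred lam]
    {κ W : ℝ} (hκ : 0 < κ) (hW : 0 < W) (hw1 : ∀ i, 1 ≤ w i) (hwW : ∀ i, w i ≤ W)
    (hs0 : ∀ i, 0 ≤ s i) (hsum : ∑ i, s i ≤ κ / 2 * ∑ i, w i)
    (hlam : ((Finset.univ.filter fun i => ¬ lam i).card : ℝ) < (Fintype.card ι : ℝ) / (2 * W)) :
    ∃ i, s i ≤ κ * w i ∧ lam i := by
  classical
  by_contra hcon
  push Not at hcon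
  set G : Finset ι := Finset.univ.filter fun i => s i ≤ κ * w i with hG
  have hGsub : G ⊆ Finset.univ.filter fun i => ¬ lam i := by
    intro i hi
    simp only [hG, Finset.mem_filter, Finset.mem_univ, true_and] at hi
    simp only [Finset.mem_filter, Finset.mem_univ, true_and]
    exact hcon i hi
  have hGcard : (G.card : ℝ) < (Fintype.card ι : ℝ) / (2 * W) :=
    lt_of_le_of_lt (by exact_mod_cast Finset.card_le_card hGsub) hlam
  have hGw : ∑ i ∈ G, w i ≤ (G.card : ℝ) * W := by
    calc ∑ i ∈ G, w i ≤ ∑ _i ∈ G, W := Finset.sum_le_sum fun i _ => hwW i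
      _ = (G.card : ℝ) * W := by rw [Finset.sum_const, nsmul_eq_mul]
  have hGw' : ∑ i ∈ G, w i < (Fintype.card ι : ℝ) / 2 := by
    have h1 : (G.card : ℝ) * W < (Fintype.card ι : ℝ) / (2 * W) * W :=
      mul_lt_mul_of_pos_right hGcard hW
    have h2 : (Fintype.card ι : ℝ) / (2 * W) * W = (Fintype.card ι : ℝ) / 2 := by
      field_simp
    linarith
  have hBw : ∑ i ∈ Finset.univ.filter (fun i => ¬ (s i ≤ κ * w i)), w i ≤ (∑ i, s i) / κ := by
    calc ∑ i ∈ Finset.univ.filter (fun i => ¬ (s i ≤ κ * w i)), w i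
        ≤ ∑ i ∈ Finset.univ.filter (fun i => ¬ (s i ≤ κ * w i)), s i / κ := by
          refine Finset.sum_le_sum fun i hi => ?_
          have hi' : κ * w i < s i := lt_of_not_ge (Finset.mem_filter.1 hi).2
          rw [le_div_iff₀ hκ]
          linarith
      _ ≤ ∑ i, s i / κ := by
          refine Finset.sum_le_univ_sum_of_nonneg fun i => ?_
          exact div_nonneg (hs0 i) hκ.le
      _ = (∑ i, s i) / κ := by rw [Finset.sum_div]
  have hsplit : ∑ i, w i = ∑ i ∈ G, w i +
      ∑ i ∈ Finset.univ.filter (fun i => ¬ (s i ≤ κ * w i)), w i :=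
    (Finset.sum_filter_add_sum_filter_not Finset.univ (fun i => s i ≤ κ * w i) w).symm
  have hn : (Fintype.card ι : ℝ) ≤ ∑ i, w i :=
    calc (Fintype.card ι : ℝ) = ∑ _i : ι, (1 : ℝ) := by simp
      _ ≤ ∑ i, w i := Finset.sum_le_sum fun i _ => hw1 i
  have hsw : (∑ i, s i) / κ ≤ (∑ i, w i) / 2 := by rw [div_le_iff₀ hκ]; linarith
  linarith

/-! ## The scales game -/

/-- **Scales game.** If beyond every threshold there is a radius at which `q L ·` holds eventually,
then for every `K` there are `K + 1` radii `≥ L₀`, pairwise `≥ R` apart, at which `q` holds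
eventually and simultaneously. [folklore] -/
theorem glueC5_scales (q : ℝ → ℕ → Prop) (L₀ R : ℝ) (hR : 0 < R)
    (h : ∀ L₁ : ℝ, ∃ L : ℝ, L₁ ≤ L ∧ ∀ᶠ N : ℕ in atTop, q L N) (K : ℕ) :
    ∃ Λ : Finset ℝ, Λ.card = K + 1 ∧ (∀ L ∈ Λ, L₀ ≤ L) ∧
      (∀ L ∈ Λ, ∀ L' ∈ Λ, L ≠ L' → R ≤ |L - L'|) ∧ ∀ᶠ N : ℕ in atTop, ∀ L ∈ Λ, q L N := by
  -- invariant with an upper bound `M` of the radii chosen so far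
  suffices hK : ∃ (Λ : Finset ℝ) (M : ℝ), Λ.card = K + 1 ∧ L₀ ≤ M ∧ (∀ L ∈ Λ, L₀ ≤ L ∧ L ≤ M) ∧
      (∀ L ∈ Λ, ∀ L' ∈ Λ, L ≠ L' → R ≤ |L - L'|) ∧ ∀ᶠ N : ℕ in atTop, ∀ L ∈ Λ, q L N by
    obtain ⟨Λ, M, h1, -, h3, h4, h5⟩ := hK
    exact ⟨Λ, h1, fun L hL => (h3 L hL).1, h4, h5⟩
  induction K with
  | zero =>
    obtain ⟨L, hL, hq⟩ := h L₀
    refine ⟨{L}, L, by simp, hL, fun L' hL' => ?_, fun L' hL' L'' hL'' hne => ?_, ?_⟩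
    · rw [Finset.mem_singleton] at hL'
      rw [hL']; exact ⟨hL, le_rfl⟩
    · rw [Finset.mem_singleton] at hL' hL''
      exact absurd (hL'.trans hL''.symm) hne
    · refine hq.mono fun N hN L' hL' => ?_
      rw [Finset.mem_singleton] at hL'
      exact hL' ▸ hN
  | succ K ih =>
    obtain ⟨Λ, M, hcard, hM, hbd, hsep, hev⟩ := ih
    obtain ⟨L', hL', hq'⟩ := h (M + R)
    have hnot : L' ∉ Λ := fun hmem => by
      have := (hbd L' hmem).2
      linarith
    refine ⟨insert L' Λ, L', ?_, by linarith, ?_, ?_, ?_⟩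
    · rw [Finset.card_insert_of_notMem hnot, hcard]
    · intro L hL
      rw [Finset.mem_insert] at hL
      rcases hL with rfl | hL
      · exact ⟨by linarith, le_rfl⟩
      · exact ⟨(hbd L hL).1, by linarith [(hbd L hL).2]⟩
    · intro L hL L'' hL'' hne
      rw [Finset.mem_insert] at hL hL''
      rcases hL with rfl | hL <;> rcases hL'' with rfl | hL''
      · exact absurd rfl hne
      · have h2 := (hbd L'' hL'').2
        rw [abs_of_nonneg (by linarith)]
        linarith
      · have h2 := (hbd L hL).2
        rw [abs_sub_comm, abs_of_nonneg (by linarith)]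
        linarith
      · exact hsep L hL L'' hL'' hne
    · filter_upwards [hq', hev] with N hN1 hN2
      intro L hL
      rw [Finset.mem_insert] at hL
      rcases hL with rfl | hL
      · exact hN1
      · exact hN2 L hL

/-! ## Window bookkeeping -/

/-- The ordered-pair sum over a particle-centred window, diagonal included (`V_LJ(0) = 0`), equals the
crux's `if`-sum. [folklore] -/
theorem glueC5_window_sum_eq {N : ℕ} (x : Fin N → E3) (i : Fin N) (L : ℝ) :
    ∑ j ∈ Finset.univ.filter (fun j : Fin N => dist (x j) (x i) ≤ L),
        ∑ k ∈ Finset.univ.filter (fun j : Fin N => dist (x j) (x i) ≤ L),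
          lennardJones (dist (x j) (x k)) =
      ∑ j : Fin N, ∑ k : Fin N,
        if j ≠ k ∧ dist (x j) (x i) ≤ L ∧ dist (x k) (x i) ≤ L then lennardJones (dist (x j) (x k))
        else 0 := by
  -- adapted from `windowFloor` (…LjLaminarWindowsWindowFloor.lean)
  rw [Finset.sum_filter]
  refine Finset.sum_congr rfl fun j _ => ?_
  rw [Finset.sum_filter]
  by_cases hj : dist (x j) (x i) ≤ L
  · rw [if_pos hj]
    refine Finset.sum_congr rfl fun k _ => ?_
    by_cases hjk : j = k
    · subst hjk
      simp [lennardJones_zero]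
    · simp [hjk, hj]
  · rw [if_neg hj]
    symm
    exact Finset.sum_eq_zero fun k _ => by simp [hj]

/-! ## The glue -/

/-- **Glue of the alternative branch (registered stub `stub_glueC5` of line `Sketch`).** A.e.
laminarity + bounded spiky scales + window removal + shell bound + path count ⇒ the crux
`LjLaminarWindows` (statement unfolded): for every sequence of Lennard-Jones ground states and every
`η, ε > 0` there is `L₀` such that for every `L ≥ L₀`, frequently in `N`, some particle-centred closed
`L`-ball is `7/10`-separated, `η`-laminar and has internal energy `≤ 2(e* + ε)` per particle.
[folklore] -/
theorem stub_glueC5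
    (hLam : ∀ t R : ℝ, 0 < t → 0 < R → ∀ x : (N : ℕ) → (Fin N → EuclideanSpace ℝ (Fin 3)),
      (∀ N, IsGroundState lennardJones (x N)) →
      Filter.Tendsto (fun N : ℕ => (Nat.card {i : Fin N // ¬ (∃ n : EuclideanSpace ℝ (Fin 3),
        ‖n‖ = 1 ∧ ∃ c : ℤ → ℝ, (∀ k : ℤ, c k + 3 / 4 ≤ c (k + 1)) ∧ ∀ j : Fin N,
          dist (x N j) (x N i) ≤ R → ∃ k : ℤ, |inner ℝ (x N j - x N i) n - c k| ≤ t)} : ℝ) / N)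
        Filter.atTop (nhds 0))
    (hBSS : ∀ κ R : ℝ, 0 < κ → 1 ≤ R → ∃ (K₀ : ℕ) (L₀ : ℝ), ∀ (N : ℕ) (x : Fin N → E3),
      (∀ j k : Fin N, j ≠ k → (7 : ℝ) / 10 ≤ dist (x j) (x k)) →
      (∀ S : Finset (Fin N), S.Nonempty → Sᶜ.Nonempty →
          ∃ p ∈ S, ∃ k ∈ Sᶜ, dist (x p) (x k) ≤ 23 / 20) →
      ∀ Λ : Finset ℝ, (∀ L ∈ Λ, L₀ ≤ L) → (∀ L ∈ Λ, ∀ L' ∈ Λ, L ≠ L' → R ≤ |L - L'|) →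
        (∀ L ∈ Λ, κ * ((Finset.univ.filter fun p : Fin N × Fin N => dist (x p.1) (x p.2) ≤ L).card : ℝ) <
            ((Finset.univ.filter fun p : Fin N × Fin N =>
                L - R < dist (x p.1) (x p.2) ∧ dist (x p.1) (x p.2) ≤ L).card : ℝ)) →
        Λ.card ≤ K₀)
    (hWR : ∀ η : ℝ, 0 < η → ∃ k₀ : ℕ, ∀ (N : ℕ) (x : Fin N → E3), IsGroundState lennardJones x →
      ∀ S : Finset (Fin N), k₀ ≤ S.card →
        ∑ i ∈ S, ∑ k ∈ S, lennardJones (dist (x i) (x k)) +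
            2 * ∑ i ∈ S, ∑ k ∈ Sᶜ, lennardJones (dist (x i) (x k)) ≤
          2 * (eStar + η) * S.card)
    (hSB : ∀ ε : ℝ, 0 < ε → ∃ R C : ℝ, 1 ≤ R ∧ 0 < C ∧ ∀ (N : ℕ) (x : Fin N → E3),
      (∀ j k : Fin N, j ≠ k → (7 : ℝ) / 10 ≤ dist (x j) (x k)) → ∀ (i : Fin N) (L : ℝ),
        ∑ j ∈ Finset.univ.filter (fun j : Fin N => dist (x j) (x i) ≤ L),
            ∑ k ∈ Finset.univ.filter (fun k : Fin N => ¬ dist (x k) (x i) ≤ L),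
              max (-lennardJones (dist (x j) (x k))) 0 ≤
          ε * ((Finset.univ.filter fun j : Fin N => dist (x j) (x i) ≤ L).card : ℝ) +
            C * ((Finset.univ.filter fun j : Fin N =>
              L - R < dist (x j) (x i) ∧ dist (x j) (x i) ≤ L).card : ℝ))
    (hPC : ∀ (N : ℕ) (x : Fin N → E3) (ρ : ℝ), 0 < ρ →
      (∀ S : Finset (Fin N), S.Nonempty → Sᶜ.Nonempty → ∃ p ∈ S, ∃ k ∈ Sᶜ, dist (x p) (x k) ≤ ρ) →
      ∀ (i : Fin N) (L : ℝ), 0 ≤ L → (∃ j : Fin N, L < dist (x j) (x i)) →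
        L / ρ ≤ ((Finset.univ.filter fun j : Fin N => dist (x j) (x i) ≤ L).card : ℝ)) :
    ∀ x : (N : ℕ) → (Fin N → EuclideanSpace ℝ (Fin 3)), (∀ N, IsGroundState lennardJones (x N)) →
      ∀ η ε : ℝ, 0 < η → 0 < ε → ∃ L₀ : ℝ, ∀ L : ℝ, L₀ ≤ L → ∃ᶠ N in Filter.atTop,
        ∃ (i : Fin N) (A : EuclideanSpace ℝ (Fin 3) →ₗᵢ[ℝ] EuclideanSpace ℝ (Fin 3)) (T : Set ℝ),
          (∀ t ∈ T, ∀ t' ∈ T, t ≠ t' → (3 : ℝ) / 4 ≤ |t - t'|) ∧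
          (∀ j k : Fin N, j ≠ k → dist (x N j) (x N i) ≤ L → dist (x N k) (x N i) ≤ L →
            (7 : ℝ) / 10 ≤ dist (x N j) (x N k)) ∧
          (∀ j : Fin N, dist (x N j) (x N i) ≤ L → ∃ t ∈ T, |(A (x N j - x N i)) 2 - t| ≤ η) ∧
          (∑ j : Fin N, ∑ k : Fin N, if j ≠ k ∧ dist (x N j) (x N i) ≤ L ∧ dist (x N k) (x N i) ≤ L
              then lennardJones (dist (x N j) (x N k)) else 0) ≤
            2 * ((⨅ Q : PeriodicConfiguration 3, Q.energyPerParticle lennardJones) + ε) *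
              (Nat.card {j : Fin N // dist (x N j) (x N i) ≤ L} : ℝ) := by
  intro x hx η ε hη hε
  classical
  -- ground-state facts used throughout
  have hsep : ∀ (N : ℕ) (j k : Fin N), j ≠ k → (7 : ℝ) / 10 ≤ dist (x N j) (x N k) :=
    fun N j k hjk => lennardJones_groundState_dist_ge_seven_tenths (hx N) hjk
  have hconn : ∀ (N : ℕ) (S : Finset (Fin N)), S.Nonempty → Sᶜ.Nonempty →
      ∃ p ∈ S, ∃ k ∈ Sᶜ, dist (x N p) (x N k) ≤ 23 / 20 := fun N => glueC5_connected (hx N)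
  -- constants
  obtain ⟨k₀, hk₀⟩ := hWR (ε / 4) (by positivity)
  obtain ⟨R, C, hR1, hC, hSB'⟩ := hSB (ε / 4) (by positivity)
  set κ : ℝ := ε / (4 * C) with hκ_def
  have hκ : 0 < κ := by positivity
  have hCκ : C * κ = ε / 4 := by rw [hκ_def]; field_simp
  obtain ⟨K₀, L₀', hBSS'⟩ := hBSS (κ / 2) R (by positivity) hR1
  set Lb : ℝ := max (max L₀' 1) (23 / 20 * k₀) with hLb
  -- spikiness of `x N` at radius `L`
  let spiky : ℝ → ℕ → Prop := fun L N =>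
    κ / 2 * ((Finset.univ.filter fun p : Fin N × Fin N => dist (x N p.1) (x N p.2) ≤ L).card : ℝ) <
      ((Finset.univ.filter fun p : Fin N × Fin N =>
        L - R < dist (x N p.1) (x N p.2) ∧ dist (x N p.1) (x N p.2) ≤ L).card : ℝ)
  -- Step 1: the scales game — beyond some `L₁ ≥ Lb`, every radius is non-spiky frequently in `N`
  have hgame : ∃ L₁ : ℝ, Lb ≤ L₁ ∧ ∀ L : ℝ, L₁ ≤ L → ∃ᶠ N : ℕ in atTop, ¬ spiky L N := by
    by_contra hcon
    push Not at hcon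
    have h' : ∀ L₁ : ℝ, ∃ L : ℝ, L₁ ≤ L ∧ ∀ᶠ N : ℕ in atTop, spiky L N := by
      intro L₁
      obtain ⟨L, hL, hnot⟩ := hcon (max L₁ Lb) (le_max_right _ _)
      exact ⟨L, le_trans (le_max_left _ _) hL, hnot⟩
    obtain ⟨Λ, hcard, hΛ0, hΛsep, hΛev⟩ := glueC5_scales spiky Lb R (by linarith) h' K₀
    obtain ⟨N, hN⟩ := hΛev.exists
    have hle := hBSS' N (x N) (hsep N) (hconn N) Λ
      (fun L hL => le_trans (le_trans (le_max_left _ _) (le_max_left _ _)) (hΛ0 L hL)) hΛsep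
      (fun L hL => hN L hL)
    omega
  obtain ⟨L₁, hL₁, hfreq⟩ := hgame
  refine ⟨L₁, fun L hL => ?_⟩
  have hLb' : Lb ≤ L := le_trans hL₁ hL
  have hL1 : 1 ≤ L := le_trans (le_trans (le_max_right _ _) (le_max_left _ _)) hLb'
  have hLpos : 0 < L := by linarith
  have hLk : 23 / 20 * (k₀ : ℝ) ≤ L := le_trans (le_max_right _ _) hLb'
  -- packing bound for ball counts
  set W : ℝ := (2 * L / (7 / 10) + 1) ^ 3 with hW
  have hWpos : 0 < W := by positivity
  -- Step 2: eventual bounds in `N`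
  have hθ : (0 : ℝ) < 1 / (2 * W) := by positivity
  have hE1 := (hLam η L hη hLpos x hx).eventually (gt_mem_nhds hθ)
  have hE2 : ∀ᶠ N : ℕ in atTop, k₀ ≤ N := eventually_ge_atTop k₀
  have hE3 : ∀ᶠ N : ℕ in atTop, 1 ≤ N := eventually_ge_atTop 1
  refine ((hfreq L hL).and_eventually (hE1.and (hE2.and hE3))).mono ?_
  rintro N ⟨hns, h1, h2, h3⟩
  have hxN := hx N
  have hNpos : (0 : ℝ) < N := by exact_mod_cast h3
  -- the laminarity predicate at radius `L`, thickness `η`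
  let lam : Fin N → Prop := fun i => ∃ n : EuclideanSpace ℝ (Fin 3), ‖n‖ = 1 ∧
    ∃ c : ℤ → ℝ, (∀ k : ℤ, c k + 3 / 4 ≤ c (k + 1)) ∧ ∀ j : Fin N,
      dist (x N j) (x N i) ≤ L → ∃ k : ℤ, |inner ℝ (x N j - x N i) n - c k| ≤ η
  -- weights (ball counts) and shell counts
  let w : Fin N → ℝ := fun i => ((Finset.univ.filter fun j : Fin N => dist (x N j) (x N i) ≤ L).card : ℝ)
  let s : Fin N → ℝ := fun i => ((Finset.univ.filter fun j : Fin N =>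
    L - R < dist (x N j) (x N i) ∧ dist (x N j) (x N i) ≤ L).card : ℝ)
  have hw1 : ∀ i, 1 ≤ w i := by
    intro i
    have hi : i ∈ Finset.univ.filter fun j : Fin N => dist (x N j) (x N i) ≤ L := by
      simp only [Finset.mem_filter, Finset.mem_univ, true_and, dist_self]
      exact hLpos.le
    have h' : 1 ≤ (Finset.univ.filter fun j : Fin N => dist (x N j) (x N i) ≤ L).card :=
      Finset.card_pos.2 ⟨i, hi⟩
    show (1 : ℝ) ≤ ((Finset.univ.filter fun j : Fin N => dist (x N j) (x N i) ≤ L).card : ℝ)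
    exact_mod_cast h'
  have hwW : ∀ i, w i ≤ W :=
    fun i => glue_ball_card_le N (x N) hxN.1 (by norm_num : (0 : ℝ) < 7 / 10) (hsep N) (x N i) hLpos.le
  have hs0 : ∀ i, 0 ≤ s i := fun i => Nat.cast_nonneg _
  have hsum : ∑ i, s i ≤ κ / 2 * ∑ i, w i := by
    have e1 : ∑ i, w i =
        ((Finset.univ.filter fun p : Fin N × Fin N => dist (x N p.1) (x N p.2) ≤ L).card : ℝ) :=
      glueC5_sum_card_dist (x N) (fun d => d ≤ L)
    have e2 : ∑ i, s i = ((Finset.univ.filter fun p : Fin N × Fin N =>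
        L - R < dist (x N p.1) (x N p.2) ∧ dist (x N p.1) (x N p.2) ≤ L).card : ℝ) :=
      glueC5_sum_card_dist (x N) (fun d => L - R < d ∧ d ≤ L)
    rw [e1, e2]
    exact le_of_not_gt hns
  have hlamcard : ((Finset.univ.filter fun i => ¬ lam i).card : ℝ) < (Fintype.card (Fin N) : ℝ) / (2 * W) := by
    have h1' := h1
    rw [glue_natCard_filter, div_lt_iff₀ hNpos] at h1'
    rw [Fintype.card_fin]
    have e : 1 / (2 * W) * (N : ℝ) = (N : ℝ) / (2 * W) := by ring
    linarith
  -- Step 3: Markov over centres — a thin-shelled laminar particle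
  obtain ⟨i, hsi, hlami⟩ := glueC5_markov w s lam hκ hWpos hw1 hwW hs0 hsum hlamcard
  -- the window of `i`
  set B : Finset (Fin N) := Finset.univ.filter fun j : Fin N => dist (x N j) (x N i) ≤ L with hB
  have hBcard : (B.card : ℝ) = w i := rfl
  -- (a) laminarity ⇒ isometry and height set
  obtain ⟨n, hn, c, hc, hwin⟩ := hlami
  obtain ⟨A, T, hT, hlamin⟩ := laminar_of_levels (x N) i L η n hn c hc hwin
  -- (b) the window holds at least `k₀` particles
  have hBk : k₀ ≤ B.card := by
    by_cases hfar : ∃ j : Fin N, L < dist (x N j) (x N i)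
    · have hpc := hPC N (x N) (23 / 20) (by norm_num) (hconn N) i L hLpos.le hfar
      have h' : (k₀ : ℝ) ≤ L / (23 / 20) := by
        rw [le_div_iff₀ (by norm_num : (0 : ℝ) < 23 / 20)]
        linarith
      exact_mod_cast h'.trans hpc
    · push Not at hfar
      have hBu : B = Finset.univ := by
        ext j
        simp only [hB, Finset.mem_filter, Finset.mem_univ, true_and, iff_true]
        exact hfar j
      rw [hBu, Finset.card_univ, Fintype.card_fin]
      exact h2
  -- (c) window removal and the shell bound
  have hrem := hk₀ N (x N) hxN B hBk
  have hcross := hSB' N (x N) (hsep N) i L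
  have hBc : Bᶜ = Finset.univ.filter fun k : Fin N => ¬ dist (x N k) (x N i) ≤ L := by rw [hB, Finset.compl_filter]
  have hneg : -(∑ j ∈ B, ∑ k ∈ Bᶜ, lennardJones (dist (x N j) (x N k))) ≤
      ∑ j ∈ B, ∑ k ∈ Finset.univ.filter (fun k : Fin N => ¬ dist (x N k) (x N i) ≤ L),
        max (-lennardJones (dist (x N j) (x N k))) 0 := by
    rw [hBc, ← Finset.sum_neg_distrib]
    refine Finset.sum_le_sum fun j _ => ?_
    rw [← Finset.sum_neg_distrib]
    exact Finset.sum_le_sum fun k _ => le_max_left _ _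
  have hshell : C * s i ≤ ε / 4 * w i := by
    have := mul_le_mul_of_nonneg_left hsi hC.le
    rw [← mul_assoc, hCκ] at this
    exact this
  have henergy : ∑ j ∈ B, ∑ k ∈ B, lennardJones (dist (x N j) (x N k)) ≤
      2 * (eStar + ε) * (B.card : ℝ) := by
    have hw0 : 0 ≤ w i := le_trans zero_le_one (hw1 i)
    have hcross' : ∑ j ∈ B, ∑ k ∈ Finset.univ.filter (fun k : Fin N => ¬ dist (x N k) (x N i) ≤ L),
        max (-lennardJones (dist (x N j) (x N k))) 0 ≤ ε / 4 * w i + C * s i := hcross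
    rw [hBcard]
    nlinarith [hrem, hneg, hcross', hshell, hw0, hε]
  -- (d) assemble
  refine ⟨i, A, T, hT, fun j k hjk _ _ => hsep N j k hjk, hlamin, ?_⟩
  rw [← glueC5_window_sum_eq (x N) i L, glue_natCard_filter]
  exact henergy

end Summit.AtomisticToContinuum.Crystallization.Theorems.LjLaminarWindowsSketch

end
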